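import Literature.Computability.Complexity.ProofComplexity
import Literature.Computability.Complexity.ProofComplexityProofs
import Literature.Computability.Complexity.TautMachine
import Literature.Computability.Complexity.CookLevinReduction
import Literature.Computability.Complexity.BrickAlgebra
import Literature.Computability.Complexity.CircuitLowerBounds
import Literature.Computability.MetaComplexity.ProofSystemsProofs
import HarnessLib

/-!
# Proof complexity: `NP = coNP` and polynomially bounded proof systems (Cook–Reckhow 1979, §1)

Sibling proof file of `ProofComplexity.lean` (D-0014). It discharges

* `Literature.Computability.Complexity.NP_eq_coNP_iff_hasPolyBoundedProofSystem_TAUT_holds`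
  (**pnp.S30(a)**, Cook–Reckhow 1979, Prop. 1.1 with Prop. 1.4): `NP = coNP` iff `TAUT` has a
  polynomially bounded abstract proof system;

and reduces the two remaining Frege-system facts of this circle,
`Literature.Computability.MetaComplexity.hasPolyBoundedProofSystem_TAUT_of_isPolyBounded`
(`Frege.lean`) and `Literature.Computability.Complexity.NP_eq_coNP_of_isPolyBounded`
(`ProofComplexity.lean`), to ONE named fact, the polynomial-time verifiability of Frege proofs
for the concrete system `textbookFrege` (`textbookFrege_hasPolyTimeVerifier`, the closing
remark of Cook–Reckhow's §1), by the theorems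
`hasPolyBoundedProofSystem_TAUT_of_isPolyBounded_of_verifier` and
`NP_eq_coNP_of_isPolyBounded_of_verifier`.

## Source and printed argument

S. A. Cook, R. A. Reckhow, *The relative efficiency of propositional proof systems*,
J. Symbolic Logic 44 (1979) 36–50, §1:

* **Proposition 1.1.** "`NP` is closed under complementation if and only if TAUT is in `NP`."
  Proof (p. 37): "The complement of the set of tautologies is in `NP`, since to verify that a
  formula is not a tautology one can guess at a truth assignment and verify that it falsifies
  the formula. Conversely, suppose the set of tautologies is in `NP`. By the proof of the main
  theorem in [Cook 1971], every set `L` in `NP` is reducible to the complement of the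
  tautologies … Hence the complement of `L` is in `NP`."
* **Definition 1.3, Proposition 1.4.** "A set `L` is in `NP` iff `L = ∅` or `L` has a
  polynomially bounded proof system." Hence (p. 37): "`NP` is closed under complementation if
  and only if TAUT has a polynomially bounded proof system".
* Closing remark of §1 (pp. 39–40): "any conventional proof system for tautologies can
  naturally be made to fit the definition of proof system in 1.3 … formulas can be naturally
  regarded as strings over a finite alphabet … an atom itself must be regarded as a string (say
  the letter P followed by a string over `{0, 1}`) … a proof `π` … can naturally be regarded as
  a string … The function `f` which abstractly specifies the system would be given by
  `f(π) = A` if `π` proves `A`, and `f(π) = A₀` for some fixed tautology `A₀` if `π` is a string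
  not corresponding to a proof"; p. 37: "For any reasonable logical theory, this verification
  can be performed within time bounded by some polynomial in `n`."

In the tree: `TAUT ∈ coNP` is `TAUT_mem_coNP_holds` (`TautMachine.lean`), Cook's theorem in the
form "every `coNP` language Karp-reduces to `TAUT`" is `CookLevin.isHard_coNP_TAUT_holds`
(`CookLevinReduction.lean`), `NP` is closed under Karp reductions
(`mem_NP_of_karpReducible_holds`), and Prop. 1.4 is `hasPolyBoundedProofSystem_iff_mem_NP_holds`
(`ProofSystemsProofs.lean`); `coNP = co NP = {L | Lᶜ ∈ NP}` by definition, so `coNP ⊆ NP`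
already gives `NP = coNP`.

## The remaining fact and the reduction

`textbookFrege_hasPolyTimeVerifier` asserts a polynomial-time verifier `V` on pairs
`⟨code of φ, certificate⟩` which is *sound* (an accepted certificate for the codeword of `φ`
makes `φ` a tautology) and *complete with polynomial overhead* (every `textbookFrege`-proof `π`
of `φ` yields an accepted certificate of length polynomial in `proofSize π + |code φ|`; the
`|code φ|` accounts for the binary variable indices of `encodingPropForm`, which `proofSize`
does not see — after substituting `⊤` for the variables of `π` not in `φ`, Cook–Reckhow's
Lemma 2.5, every line is a string of length `O(size · log |code φ|)`). Given such a `V`, the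
verifier `V' w c := (chkTaut w [] = false) ∧ V w c` is a Cook–Reckhow proof system for `TAUT`
on *all* strings: the checker `chkTaut` of `TautCertificates.lean` accepts every non-codeword
(`chkTaut_of_not_mem_range`), so `chkTaut w [] = false` certifies in polynomial time
(`TautProg.tautFn_mem_FP`) that `w` is a codeword, and it holds for every codeword of a tautology
(`not_mem_TAUT_iff`). If `textbookFrege` is polynomially bounded, `V'` is polynomially bounded
(`hasPolyBoundedProofSystem_TAUT_of_verifier`); any polynomially bounded Frege system makes
`textbookFrege` polynomially bounded (`isPolyBounded_iff_of_isFrege_holds`, Cor. 2.4, with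
`isFrege_textbookFrege_holds`), whence the two reductions.

## References

* S. A. Cook, R. A. Reckhow, *The relative efficiency of propositional proof systems*,
  J. Symbolic Logic 44 (1979) 36–50: §1, Prop. 1.1, Def. 1.3, Prop. 1.4, Def. 1.5, Prop. 1.6,
  closing remark of §1 (pp. 39–40); §2, Def. 2.1–2.2, Cor. 2.4, Lemma 2.5.
* J. Krajíček, *Bounded arithmetic, propositional logic, and complexity theory*, CUP 1995,
  p. 27, Thm. 4.1.2.
-/

namespace Literature.Computability.Complexity

open _root_.Computability Nondeterministic MetaComplexity Polynomial

/-! ### pnp.S30(a): `NP = coNP ↔ TAUT` has a polynomially bounded proof system -/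

/-- **Discharge of `NP_eq_coNP_iff_hasPolyBoundedProofSystem_TAUT`** (Cook–Reckhow 1979,
Prop. 1.1 with Prop. 1.4). (`→`) `TAUT ∈ coNP = NP` (`TAUT_mem_coNP_holds`), and an `NP`
language has a polynomially bounded proof system (Prop. 1.4,
`hasPolyBoundedProofSystem_iff_mem_NP_holds`). (`←`) `TAUT ∈ NP` by Prop. 1.4; every
`L ∈ coNP` Karp-reduces to `TAUT` (Cook's theorem, `CookLevin.isHard_coNP_TAUT_holds`) and `NP`
is closed under Karp reductions (`mem_NP_of_karpReducible_holds`), so `coNP ⊆ NP`; and then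
`L ∈ NP ⇒ Lᶜ ∈ coNP ⊆ NP ⇒ L ∈ coNP`. [cite: CookReckhow1979, §1  Prop. 1.1 / Corollary] -/
theorem NP_eq_coNP_iff_hasPolyBoundedProofSystem_TAUT_holds :
    NP_eq_coNP_iff_hasPolyBoundedProofSystem_TAUT := by
  have h14 : HasPolyBoundedProofSystem TAUT ↔ TAUT ∈ NP :=
    hasPolyBoundedProofSystem_iff_mem_NP_holds
  unfold NP_eq_coNP_iff_hasPolyBoundedProofSystem_TAUT
  constructor
  · intro h
    have hT : TAUT ∈ coNP := TAUT_mem_coNP_holds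
    rw [← h] at hT
    exact h14.2 hT
  · intro h
    have hT : TAUT ∈ NP := h14.1 h
    have hsub : coNP ⊆ NP := fun L hL =>
      mem_NP_of_karpReducible_holds (CookLevin.isHard_coNP_TAUT_holds L hL) hT
    refine Set.Subset.antisymm (fun L hL => ?_) hsub
    have hc : Lᶜ ∈ coNP := by
      change Lᶜᶜ ∈ NP
      rwa [compl_compl]
    exact hsub hc

/-! ### The remaining fact: Frege proofs are checkable in polynomial time -/

/-- **Frege proofs are polynomial-time verifiable** (named fact; Cook–Reckhow 1979, closing
remark of §1 with §2, Def. 2.1–2.2), for the concrete Frege system `textbookFrege` and the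
tree's string encoding of formulas `encodingPropForm`: there is a polynomial-time verifier `V`
(`IsPolyTimeVerifier`: time polynomial in `|⟨w, c⟩|`) such that
* (soundness) if `V` accepts a certificate `c` for the codeword of a formula `φ`, then `φ` is a
  tautology (equivalently, by `isFrege_textbookFrege_holds`, `textbookFrege`-provable);
* (completeness with polynomial overhead) for some polynomial `q`, every `textbookFrege`-proof
  `π` of `φ` yields an accepted certificate of length at most `q (proofSize π + |code φ|)`.
The certificate is "the proof written as a string" (loc. cit.: atoms as a letter followed by a
binary string, lines separated by commas; "`f(π) = A` if `π` proves `A`"); the summand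
`|code φ|` in the bound is forced by the tree's encoding, in which a variable `var i` of
`proofSize` one occupies `O(log i)` bits: by Lemma 2.5 (loc. cit.) the variables of `π` not
occurring in `φ` may first be replaced by `⊤` without changing sizes, after which every line
has string length `O(size · |code φ|)`. Nothing is asserted about inputs `w` that are not
codewords (cf. `hasPolyBoundedProofSystem_TAUT_of_verifier`, which adds the codeword test).
[cite: CookReckhow1979, §1 (closing remark: conventional proof systems fit Def. 1.3) and §2 Def. 2.1–2.2] -/
def textbookFrege_hasPolyTimeVerifier : Prop :=
  ∃ V : List Bool → List Bool → Bool, IsPolyTimeVerifier V ∧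
    (∀ (φ : PropForm ℕ) (c : List Bool),
      V (encodingPropForm.encode φ) c = true → φ.IsTautology) ∧
    ∃ q : Polynomial ℕ, ∀ (φ : PropForm ℕ) (π : List (PropForm ℕ)),
      textbookFrege.IsProofOf π φ →
        ∃ c : List Bool, c.length ≤ q.eval (proofSize π + (encodingPropForm.encode φ).length) ∧
          V (encodingPropForm.encode φ) c = true

/-! ### From the verifier to a polynomially bounded proof system for `TAUT` -/

/-- The size of a formula is at most the length of its codeword
(`encode φ = boolPair (unary φ.size) (code φ)`). [folklore] -/
theorem size_le_length_encode (φ : PropForm ℕ) :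
    φ.size ≤ (encodingPropForm.encode φ).length := by
  change φ.size ≤ (boolPair (unaryEncodeNat φ.size) φ.code).length
  rw [length_boolPair, unaryEncodeNat_eq_replicate, List.length_replicate]
  omega

/-- A codeword of a tautology passes the codeword test `chkTaut w [] = false`
(`not_mem_TAUT_iff`). [cite: AroraBarakCC2009, Example 2.21] -/
theorem chkTaut_nil_eq_false_of_mem_TAUT {w : List Bool} (hw : w ∈ TAUT) : chkTaut w [] = false := by
  by_contra h
  have h' : chkTaut w [] = true := by simpa using h
  exact (not_mem_TAUT_iff w).2 ⟨[], by simp, h'⟩ hw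

/-- A string passing the codeword test is a codeword (`chkTaut_of_not_mem_range`). [folklore] -/
theorem mem_range_encode_of_chkTaut_nil {w : List Bool} (h : chkTaut w [] = false) :
    w ∈ Set.range encodingPropForm.encode := by
  by_contra hw
  have := chkTaut_of_not_mem_range hw []
  simp [this] at h

/-- A polynomial-time verifier (a machine specified on pairs `boolPair x c`) gives a total
one-bit string function in `FP`, `z ↦ [V (boolUnpair z).1 (boolUnpair z).2]`, by running it after
the re-pairing machine `polyTimeComputable_boolUnpair`. [cite: AroraBarakCC2009, §0.1] -/
theorem verifierFn_mem_FP {V : List Bool → List Bool → Bool} (hV : IsPolyTimeVerifier V) :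
    (fun z => [V (boolUnpair z).1 (boolUnpair z).2]) ∈ FP := by
  have h := PolyTimeComputable.comp_holds hV polyTimeComputable_boolUnpair
  exact h.of_encode (eb := id) id (fun _ => rfl) (fun _ => rfl)

/-- The combined verifier as a string function: codeword test AND Frege verifier. [folklore] -/
noncomputable def tautVerifierFn (V : List Bool → List Bool → Bool) : List Bool → List Bool :=
  Brick.andFn (Brick.notFn (TautProg.tautFn ∘ fanoutFn Brick.fstF (fun _ => [])))
    (fun z => [V (boolUnpair z).1 (boolUnpair z).2])

/-- `tautVerifierFn V ∈ FP` for a polynomial-time verifier `V`. [folklore] -/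
theorem tautVerifierFn_mem_FP {V : List Bool → List Bool → Bool} (hV : IsPolyTimeVerifier V) :
    tautVerifierFn V ∈ FP :=
  Brick.andFn_mem_FP
    (Brick.notFn_mem_FP (comp_mem_FP TautProg.tautFn_mem_FP
      (fanoutFn_mem_FP Brick.fstF_mem_FP (const_mem_FP _))))
    (verifierFn_mem_FP hV)

/-- Value of the combined verifier on a pair. [folklore] -/
theorem tautVerifierFn_boolPair (V : List Bool → List Bool → Bool) (w c : List Bool) :
    tautVerifierFn V (boolPair w c) = [!(chkTaut w []) && V w c] := by
  unfold tautVerifierFn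
  have h1 : (TautProg.tautFn ∘ fanoutFn Brick.fstF (fun _ => [])) (boolPair w c) = [chkTaut w []] := by
    simp [TautProg.tautFn_boolPair]
  have h2 : (fun z => [V (boolUnpair z).1 (boolUnpair z).2]) (boolPair w c) = [V w c] := by
    simp
  rw [Brick.andFn_apply (Brick.notFn_apply h1) h2]

/-- The combined verifier, as a Cook–Reckhow verifier `V' w c`. [folklore] -/
noncomputable def tautVerifier (V : List Bool → List Bool → Bool) (w c : List Bool) : Bool :=
  !(chkTaut w []) && V w c

/-- `tautVerifier V` is a polynomial-time verifier. [folklore] -/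
theorem isPolyTimeVerifier_tautVerifier {V : List Bool → List Bool → Bool}
    (hV : IsPolyTimeVerifier V) : IsPolyTimeVerifier (tautVerifier V) := by
  refine (tautVerifierFn_mem_FP hV).of_encode (fun p : List Bool × List Bool => boolPair p.1 p.2)
    (fun _ => rfl) fun p => ?_
  obtain ⟨w, c⟩ := p
  simp only [id, tautVerifierFn_boolPair]
  rfl

/-- **A polynomially bounded proof system for `TAUT` from the Frege verifier.** If
`textbookFrege` has a polynomial-time verifier in the sense of
`textbookFrege_hasPolyTimeVerifier` and is polynomially bounded, then `TAUT` has a polynomially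
bounded Cook–Reckhow proof system, namely `tautVerifier V`: soundness by the codeword test and
the soundness of `V`; completeness by the completeness of `textbookFrege`
(`isFrege_textbookFrege_holds`) and of `V`; polynomial boundedness since a tautology `φ` has a
proof of size `≤ p(φ.size) ≤ p(|code φ|)` and hence a certificate of length
`≤ q(p(|code φ|) + |code φ|)`. [cite: CookReckhow1979, §1 (Def. 1.3, closing remark) and §2 Cor. 2.4] -/
theorem hasPolyBoundedProofSystem_TAUT_of_verifier (hV : textbookFrege_hasPolyTimeVerifier)
    (hpb : textbookFrege.IsPolyBounded) : HasPolyBoundedProofSystem TAUT := by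
  obtain ⟨V, hVpoly, hsound, q, hcomplete⟩ := hV
  obtain ⟨p, hp⟩ := hpb
  have hF : IsFrege textbookFrege := isFrege_textbookFrege_holds
  -- every codeword of a tautology has a short accepted certificate
  have hshort : ∀ φ : PropForm ℕ, φ.IsTautology →
      ∃ c : List Bool, c.length ≤ (q.comp (p + X)).eval (encodingPropForm.encode φ).length ∧
        tautVerifier V (encodingPropForm.encode φ) c = true := by
    intro φ hφ
    obtain ⟨π, hπ, hsize⟩ := hp φ hφ
    obtain ⟨c, hc, hVc⟩ := hcomplete φ π hπ
    refine ⟨c, hc.trans ?_, ?_⟩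
    · rw [eval_comp, eval_add, eval_X]
      refine natPoly_eval_mono q (Nat.add_le_add_right (hsize.trans ?_) _)
      exact natPoly_eval_mono p (size_le_length_encode φ)
    · have h0 := chkTaut_nil_eq_false_of_mem_TAUT ((mem_TAUT_iff φ).2 hφ)
      simp [tautVerifier, h0, hVc]
  -- soundness of the combined verifier
  have hsnd : ∀ w c, tautVerifier V w c = true → ∃ φ : PropForm ℕ,
      w = encodingPropForm.encode φ ∧ φ.IsTautology := by
    intro w c h
    simp only [tautVerifier, Bool.and_eq_true, Bool.not_eq_true'] at h
    obtain ⟨φ, rfl⟩ := mem_range_encode_of_chkTaut_nil h.1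
    exact ⟨φ, rfl, hsound φ c h.2⟩
  refine ⟨tautVerifier V, ⟨isPolyTimeVerifier_tautVerifier hVpoly, fun w => ?_⟩,
    q.comp (p + X), fun w c h => ?_⟩
  · constructor
    · rintro ⟨φ, hφ, rfl⟩
      obtain ⟨c, -, hc⟩ := hshort φ hφ
      exact ⟨c, hc⟩
    · rintro ⟨c, hc⟩
      obtain ⟨φ, rfl, hφ⟩ := hsnd w c hc
      exact (mem_TAUT_iff φ).2 hφ
  · obtain ⟨φ, rfl, hφ⟩ := hsnd w c h
    exact hshort φ hφ

/-- **Reduction of `hasPolyBoundedProofSystem_TAUT_of_isPolyBounded` (`Frege.lean`) to the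
verifier fact**: a polynomially bounded Frege system `F` makes `textbookFrege` polynomially
bounded (Cook–Reckhow Cor. 2.4, `isPolyBounded_iff_of_isFrege_holds`), and then
`hasPolyBoundedProofSystem_TAUT_of_verifier` applies. [cite: CookReckhow1979, §1–2] -/
theorem hasPolyBoundedProofSystem_TAUT_of_isPolyBounded_of_verifier
    (hV : textbookFrege_hasPolyTimeVerifier) : hasPolyBoundedProofSystem_TAUT_of_isPolyBounded := by
  intro F hF h
  have hiff : F.IsPolyBounded ↔ textbookFrege.IsPolyBounded :=
    isPolyBounded_iff_of_isFrege_holds hF isFrege_textbookFrege_holds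
  exact hasPolyBoundedProofSystem_TAUT_of_verifier hV (hiff.1 h)

/-- **Reduction of `NP_eq_coNP_of_isPolyBounded` (pnp.S30 corollary) to the verifier fact**: a
polynomially bounded Frege system gives a polynomially bounded proof system for `TAUT`
(`hasPolyBoundedProofSystem_TAUT_of_isPolyBounded_of_verifier`), hence `NP = coNP`
(`NP_eq_coNP_iff_hasPolyBoundedProofSystem_TAUT_holds`). [cite: CookReckhow1979, §1–2] -/
theorem NP_eq_coNP_of_isPolyBounded_of_verifier (hV : textbookFrege_hasPolyTimeVerifier) :
    NP_eq_coNP_of_isPolyBounded := by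
  intro F hF h
  have hiff : NP = coNP ↔ HasPolyBoundedProofSystem TAUT :=
    NP_eq_coNP_iff_hasPolyBoundedProofSystem_TAUT_holds
  exact hiff.2 (hasPolyBoundedProofSystem_TAUT_of_isPolyBounded_of_verifier hV hF h)

end Literature.Computability.Complexity
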